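import Mathlib

/-!
# The triple product property hidden in a level-one separation clause
# (crux `LevelGradedCohnUmans.GradedDesignFamily`, stmt-MatrixMultiplication-7610; negative side,
# line `quadratic-extension-level-one-cell`, stub `gl2Flat_tpp_of_separators`)

Let `φ : SL₂(k) →* GL₂(K)` and let `Y, Z ⊆ GL₂(K)` be finite sets which are *level-one separated*
against `H = φ(SL₂ k)`: for every target `z₀ ∈ Z` there is a "frame function"
`g ↦ ∑ u, cf u (g • u)` on `GL₂(K)` reading the indicator `[a = 1 ∧ y = y' ∧ z = z₀]` at every
group element `φ a * y * y'⁻¹ * z` (`y, y' ∈ Y`, `z ∈ Z`).  Then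

* `gl2Flat_tpp_of_separators` — the triple product property: if `φ a * y * y'⁻¹ * z = z'` with
  `y, y' ∈ Y` and `z, z' ∈ Z`, then `a = 1`, `y = y'` and `z = z'`.

Proof: take the separator `cf` of the target `z'`.  It reads `[a = 1 ∧ y = y' ∧ z = z']` at the
matrix `φ a * y * y'⁻¹ * z`, and it reads `1` at `φ 1 * y * y⁻¹ * z' = z'`.  The two group elements
coincide by hypothesis, so the two readings coincide, forcing the condition (otherwise `0 = 1`).

This is the ingredient giving the lower bound `|Γ| ≥ (|Y| - 1) |Z|` on the garbage
`Γ = H · (Y Y⁻¹ ∖ 1) · Z` in the flat-size lemma of the line's negative programme.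

Sorry-free; axioms `propext`, `Classical.choice`, `Quot.sound`.
-/

set_option linter.dupNamespace false

open scoped BigOperators

namespace Summit.MatrixMultiplication.MatrixMultiplication.Theorems.GradedDesignFamily.Negative

/-- **Triple product property from separators.**  If `Y, Z ⊆ GL₂(K)` are level-one separated
against `φ(SL₂ k)` (for each `z₀ ∈ Z` a frame function `g ↦ ∑ u, cf u (g • u)` reads
`[a = 1 ∧ y = y' ∧ z = z₀]` at `φ a * y * y'⁻¹ * z`), then
`φ a * y * y'⁻¹ * z = z'` with `y, y' ∈ Y`, `z, z' ∈ Z` forces `a = 1`, `y = y'`, `z = z'`. -/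
theorem gl2Flat_tpp_of_separators : ∀ {k K : Type} [Field k] [Fintype k] [DecidableEq k]
    [Field K] [Fintype K] [DecidableEq K]
    (φ : Matrix.SpecialLinearGroup (Fin 2) k →* Matrix.GeneralLinearGroup (Fin 2) K)
    (Y Z : Finset (Matrix.GeneralLinearGroup (Fin 2) K)),
    (∀ z₀ ∈ Z, ∃ cf : (Fin 2 → K) → (Fin 2 → K) → ℂ,
      ∀ a : Matrix.SpecialLinearGroup (Fin 2) k, ∀ y ∈ Y, ∀ y' ∈ Y, ∀ z ∈ Z,
        (∑ u : Fin 2 → K, cf u (((φ a * y * y'⁻¹ * z : Matrix.GeneralLinearGroup (Fin 2) K) :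
            Matrix (Fin 2) (Fin 2) K).mulVec u)) = if a = 1 ∧ y = y' ∧ z = z₀ then 1 else 0) →
    ∀ a : Matrix.SpecialLinearGroup (Fin 2) k, ∀ y ∈ Y, ∀ y' ∈ Y, ∀ z ∈ Z, ∀ z' ∈ Z,
      φ a * y * y'⁻¹ * z = z' → a = 1 ∧ y = y' ∧ z = z' := by
  intro k K _ _ _ _ _ _ φ Y Z hsep a y hy y' hy' z hz z' hz' h
  -- the separator of the target `z'`
  obtain ⟨cf, hcf⟩ := hsep z' hz'
  -- its reading at `φ a * y * y'⁻¹ * z` ...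
  have h1 := hcf a y hy y' hy' z hz
  -- ... and at `φ 1 * y * y⁻¹ * z' = z'`
  have h2 := hcf 1 y hy y hy z' hz'
  -- the two group elements coincide
  have hg : φ 1 * y * y⁻¹ * z' = φ a * y * y'⁻¹ * z := by
    rw [map_one, one_mul, mul_inv_cancel, one_mul, h]
  rw [if_pos ⟨rfl, rfl, rfl⟩, hg, h1] at h2
  -- `h2 : (if a = 1 ∧ y = y' ∧ z = z' then 1 else 0) = 1`
  by_contra hc
  rw [if_neg hc] at h2
  exact zero_ne_one h2

end Summit.MatrixMultiplication.MatrixMultiplication.Theorems.GradedDesignFamily.Negative
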